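import Summits.KontsevichZagierPeriods.KontsevichZagierPeriods.Theorems.HurwitzMicroSectorsNormalFormPrincipleAlgDlogMoves

/-!
# `NormalFormPrinciple` (stmt-KontsevichZagierPeriods-3869), line `SketchIdeator1` — the dlog
# scaling move `dlog_scale_mem_relations`, by reduction to the landed algebraic layer (siege k7)

The registered sub-goal `dlog_scale_mem_relations` of the dlog layer of the leaf
`stub_boxRigidity`: for rationals `a, b, c, s` with `0 < a`, `0 < s` and two integral
representations of dimension one, `L = [(a, b), c/y]` and `L' = [(s a, s b), c/y]`,
the difference `[L] − [L']` lies in `KZ.relations` (rule (2) of the Kontsevich–Zagier calculus,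
the dilation `y ↦ s y` of Jacobian `s`, `c/y = (c/(s y)) · s`).

This is the best-of-10 siege variant k7, "reduce to landed lemmas of this crux, then assemble".
The crux already carries, LANDED, the same move for real ALGEBRAIC data —
`PiBox.Dlog.dlogA_scale_mem_relations`
(`Theorems/HurwitzMicroSectorsNormalFormPrincipleAlgDlogMoves.lean`, the algebraic-pole layer):
for `s : ℝ` algebraic over `ℚ`, `0 < s`, `0 < a`, and the slabs `{a < y < b}`, `{s a < y < s b}`
with integrands `c / y`, `[L] − [L'] ∈ relations`. The rational statement is its specialisation
along the cast `ℚ → ℝ`: a rational `s` is algebraic (`isAlgebraic_algebraMap`), the endpoints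
`((s * a : ℚ) : ℝ) = (s : ℝ) * (a : ℝ)` agree by `Rat.cast_mul`, and positivity transfers by
`Rat.cast_pos`. No new analysis, no new definitions; the statement (registered signature) is
that of the lead's `PiBox.Dlog.dlog_scale_mem_relations`, proved here in its own namespace.

Source: M. Kontsevich, D. Zagier, *Periods* (2001), §1.2, rule (2) (change of variables).
-/

noncomputable section

open Set
open Literature.NumberTheory.Transcendental Literature.NumberTheory.Transcendental.KZ

namespace Summit.KontsevichZagierPeriods.HurwitzMicroSectors.NormalFormPrinciple.DlogScaleK7

open Summit.KontsevichZagierPeriods.HurwitzMicroSectors.NormalFormPrinciple.PiBox.Dlog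
  (dlogA_scale_mem_relations)

/-- **Scaling** (rule 2) for the dlog representations over `ℚ`: for rationals `a, b, c, s` with
`0 < a` and `0 < s`, `[(a,b), c/y] − [(sa, sb), c/y] ∈ relations`. Registered sub-goal
`dlog_scale_mem_relations` of crux stmt-KontsevichZagierPeriods-3869 (line `SketchIdeator1`,
dlog layer of `stub_boxRigidity`), obtained by specialising the landed algebraic-data move
`PiBox.Dlog.dlogA_scale_mem_relations` to the rational (hence algebraic) factor `s`, after
rewriting the cast endpoints `((s * a : ℚ) : ℝ) = s * a`, `((s * b : ℚ) : ℝ) = s * b`.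
[cite: KontsevichZagier2001, §1.2 rule (2)] -/
theorem dlog_scale_mem_relations {a b c s : ℚ} (L L' : IntegralRep 1)
    (hd : L.domain = {x | x 0 ∈ Set.Ioo (a:ℝ) b})
    (hd' : L'.domain = {x | x 0 ∈ Set.Ioo ((s * a : ℚ):ℝ) ((s * b : ℚ):ℝ)})
    (hi : EqOn L.integrand (fun x => (c:ℝ) / x 0) L.domain)
    (hi' : EqOn L'.integrand (fun x => (c:ℝ) / x 0) L'.domain) (ha : 0 < a) (hs : 0 < s) :
    of L - of L' ∈ relations :=
  dlogA_scale_mem_relations (s := (s:ℝ)) (isAlgebraic_algebraMap s) L L' hd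
    (by rw [hd', Rat.cast_mul, Rat.cast_mul]) hi hi' (Rat.cast_pos.mpr ha) (Rat.cast_pos.mpr hs)

end Summit.KontsevichZagierPeriods.HurwitzMicroSectors.NormalFormPrinciple.DlogScaleK7

end
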